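import Summits.ResolutionOfSingularities.ResolutionOfSingularities.Theorems.PurelyInseparableDim4ResConeTwoSlotLegalitySigma
import HarnessLib
import HarnessLib.Audit.Tags

/-!
# Purely inseparable four-folds — TWO-SLOT POWER-CONE GAME, THE TSCHIRNHAUS ROW IS SELF-SUPPLYING: after a pure corner step in a slot
# the whole row `x_f^{d−1}·(…)` of the child is divisible by that slot, and in the run letter the row shifts by one power, exactly
# (cell `res-dim4-pi`, K2(p) lane, B rows, row B-LF (iii-b) «K24a-PRIME-σ», assembly δ part 1; seat res-dim4-p-7 g6)

[OURS · counted 0 · cell `res-dim4-pi` · K2(p) lane (holder res-dim4-p-12 g5 rulings g5-17/g5-18: «ASSEMBLY δ = p-7 g6»); answers res-dim4-typ-1 g5's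
scoping erratum (bus 2026-08-29 12:42Z, «who re-supplies `htsch_κ` each step») with a chart-law identity: nobody has to — text bus 12:44Z.
Seat res-dim4-p-7 g6.]  Nothing here proves any TAIL(p, d, 3), K2(p), `NoIsolatedTrap p p` or resolution of singularities in dimension ≥ 4 /
characteristic `p` — NOT proved; exponent bookkeeping of ONE pure corner step of OUR frame.  AI kernel work, weaker than expert review.

SETTING (res-dim4-p-1 g6's σ-dictionary, `…TwoSlotGameStepSigma` p719168): slots `j, i` of weight `n`, third letter `u` of weight `w`, carrier `f`;
`r = n·j + n·i + w·u`, `n + w + d = p`; the TSCHIRNHAUS ROW = residual exponents `(d−1)·f + m̃_u` (game letter `c = 0`, row weight `1`); pure corner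
step `s′ = CentreBlowup.step p univ j 0 s`.  Only `x^r ∣ F` and `ord₀ F ≥ p` are used — no straightness, no shade, no `e_G`.
* §1 **`coeff_tschRow_step_zero_eq_zero_sigma`** (A) — after a `j`-step every child coefficient at `r + (d−1)·f + a·i + b·u` with `2 ≤ a + b`
  (row `d − 1`, `j`-exponent `0`) VANISHES: its only possible parent would have `u`-degree `1` (no births, `exists_of_mem_support_step_zero`).
  In particular `coeff (r + (d−1)·f + m·i) s′.F = 0` for every `m ≥ 2`: the OTHER slot's Tschirnhaus powers are all supplied.
* §2 **`coeff_tschRow_pure_step_zero_sigma`** (B) — in the run letter the row shifts exactly: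
  `coeff (r + (d−1)·f + m·j) s′.F = coeff (r + (d−1)·f + (m+1)·j) s.F` (`m ≥ 1`; the exponent has `f`-entry `d − 1 ∈ [1, p − 2]`, never a
  `p`-th power, so cleaning does not touch it).
* §3 **`tschRow_pure_of_run_sigma`** — along a pure-corner two-slot play `s (t+1) = step p univ (κ t) 0 (s t)`, `κ t ∈ {j, i}`: if all pure
  powers `m ≥ 2` of the letter `κ t₁` vanish in the row at time `t₁` and `κ` is constant on `[t₁, t₁ + k]`, they all vanish at `t₁ + k`; with (A):
  **`htsch_of_change_sigma`** — at any time `t + 1` whose chart letter is the letter of a run started after a letter change, the binder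
  `coeff (r + (d−1)·f + 2·(κ (t+1))) (s (t+1)).F = 0` of `twoSlot_legal_readings_of_corner_sigma` holds.  So after the FIRST letter change the
  straight frame needs no re-straightening and no second Tschirnhaus: ONE coefficient at the entry state suffices (δ part 2).
[cite: CossartJannsenSaito2020, Lemma 13.2] [cite: HauserPerlega2019PRIMS, §2 (the blowup in the x₁-chart)]
bears_on: LADDER-RESOLUTION:D157-DOOR2 (res-dim4-pi · K2(p) · power cones · K24a-PRIME-σ assembly δ part 1).  Supports
stmt-ResolutionOfSingularities-16155 (helper).
-/

set_option linter.dupNamespace false -- mandated namespace of this single-conjunct summit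

noncomputable section

namespace Summit.ResolutionOfSingularities.ResolutionOfSingularities.Theorems.PIDim4

namespace ResCone

open MvPolynomial Finset
open Literature.AlgebraicGeometry.Resolution
open Literature.AlgebraicGeometry.Resolution.CentreBlowup
open Literature.AlgebraicGeometry.Resolution.Hauser2010
open Literature.AlgebraicGeometry.Resolution.HauserPerlega2019

variable {K : Type} [Field K] [DecidableEq K]

section Letters

variable {j i u f : Fin 4} (hji : j ≠ i) (hju : j ≠ u) (hjf : j ≠ f) (hiu : i ≠ u) (hif : i ≠ f) (huf : u ≠ f)
include hji hju hjf hiu hif huf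

/-! ## 1. (A) After a `j`-step the Tschirnhaus row of the child is divisible by `x_j` -/

/-- **(A) THE OTHER LETTERS' TSCHIRNHAUS POWERS ARE SUPPLIED BY THE STEP ITSELF.**  Boundary `r = n·j + n·i + w·u`, `n + w + d = p`, `x^r ∣ F`,
`ord₀ F ≥ p` (any state of the band); pure corner step in the slot `j`.  Then every coefficient of the child at a row-`(d−1)` exponent with
`j`-exponent ZERO, `r + (d−1)·f + a·i + b·u` with `2 ≤ a + b`, vanishes: a parent monomial mapping there would have `u`-degree `a + b + m_j`
with image `j`-exponent `a + b + m_j − 1 = 0`, impossible. [OURS] [cite: CossartJannsenSaito2020, Lemma 13.2] -/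
theorem coeff_tschRow_step_zero_eq_zero_sigma (p : ℕ) {n w d : ℕ} (hσ : n + w + d = p) {s : State K}
    (hr : s.r = Finsupp.single j n + Finsupp.single i n + Finsupp.single u w) (hdiv : ∀ e ∈ s.F.support, s.r ≤ e)
    (hq : ((p : ℕ) : ℕ∞) ≤ ordAlong Finset.univ s.F) {a b : ℕ} (hab : 2 ≤ a + b) :
    coeff (s.r + (Finsupp.single f (d - 1) + Finsupp.single i a + Finsupp.single u b))
      (CentreBlowup.step p Finset.univ j 0 s).F = 0 := by
  by_contra hne
  obtain ⟨e, he, heE⟩ := exists_of_mem_support_step_zero j s (MvPolynomial.mem_support_iff.mpr hne)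
  obtain ⟨m, rfl⟩ : ∃ m, e = s.r + m := ⟨e - s.r, (add_tsub_cancel_of_le (hdiv e he)).symm⟩
  have hrdeg : s.r.degree = 2 * n + w := by
    rw [hr, map_add, map_add, Finsupp.degree_single, Finsupp.degree_single, Finsupp.degree_single]; ring
  -- degree of the parent monomial: at least `p`
  have hdege : p ≤ (s.r + m).degree := by
    have h := Finset.inf_le (f := fun e : Fin 4 →₀ ℕ => ((degIn Finset.univ e : ℕ) : ℕ∞)) he
    have h' : ordAlong Finset.univ s.F ≤ ((degIn Finset.univ (s.r + m) : ℕ) : ℕ∞) := h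
    rw [degIn_univ] at h'
    exact_mod_cast hq.trans h'
  -- both sides of the image equation on four named letters
  have hL : s.r + m = Finsupp.single j (n + m j) + Finsupp.single i (n + m i) + Finsupp.single u (w + m u) +
      Finsupp.single f (m f) := by
    rw [hr]; ext k
    rcases letters_exhaust hji hju hjf hiu hif huf k with rfl | rfl | rfl | rfl
    · simp [hji, hju, hjf]
    · simp [hji.symm, hiu, hif]
    · simp [hju.symm, hiu.symm, huf]
    · simp [hjf.symm, hif.symm, huf.symm]
  have hR : s.r + (Finsupp.single f (d - 1) + Finsupp.single i a + Finsupp.single u b) =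
      Finsupp.single j n + Finsupp.single i (n + a) + Finsupp.single u (w + b) + Finsupp.single f (d - 1) := by
    rw [hr]; ext k
    rcases letters_exhaust hji hju hjf hiu hif huf k with rfl | rfl | rfl | rfl
    · simp [hji, hju, hjf]
    · simp [hji.symm, hiu, hif]
    · simp [hju.symm, hiu.symm, huf]
    · simp [hjf.symm, hif.symm, huf.symm]
  have hdegL : (s.r + m).degree = (n + m j) + (n + m i) + (w + m u) + m f := by rw [hL]; exact degree_quad j i u f _ _ _ _
  rw [hR, chartExponent_univ_eq_update] at heE
  obtain ⟨q1, q2, q3, q4⟩ := quad_apply hji hju hjf hiu hif huf n (n + a) (w + b) (d - 1)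
  obtain ⟨l1, l2, l3, l4⟩ := quad_apply hji hju hjf hiu hif huf (n + m j) (n + m i) (w + m u) (m f)
  have hj' := DFunLike.congr_fun heE j
  have hi' := DFunLike.congr_fun heE i
  have hu' := DFunLike.congr_fun heE u
  have hf' := DFunLike.congr_fun heE f
  rw [Finsupp.coe_update, Function.update_self, q1] at hj'
  rw [Finsupp.coe_update, Function.update_of_ne hji.symm, q2, hL, l2] at hi'
  rw [Finsupp.coe_update, Function.update_of_ne hju.symm, q3, hL, l3] at hu'
  rw [Finsupp.coe_update, Function.update_of_ne hjf.symm, q4, hL, l4] at hf'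
  omega

/-! ## 2. (B) In the run letter the Tschirnhaus row shifts by one power, exactly -/

omit hiu in
/-- **(B) THE RUN LETTER'S ROW SHIFTS**: `coeff (r + (d−1)·f + m·j) (step p univ j 0 s).F = coeff (r + (d−1)·f + (m+1)·j) s.F` for `m ≥ 1`
(`2 ≤ d`, so the `f`-entry `d − 1 ∈ [1, p − 2]` of the image forbids a `p`-th power: no cleaning). [OURS]
[cite: HauserPerlega2019PRIMS, §2 (the blowup in the x₁-chart)] -/
theorem coeff_tschRow_pure_step_zero_sigma (p : ℕ) {n w d : ℕ} (hσ : n + w + d = p) (hn : 1 ≤ n) (hd2 : 2 ≤ d) {s : State K}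
    (hr : s.r = Finsupp.single j n + Finsupp.single i n + Finsupp.single u w)
    (hq : ((p : ℕ) : ℕ∞) ≤ ordAlong Finset.univ s.F) {m : ℕ} (hm : 1 ≤ m) :
    coeff (s.r + (Finsupp.single f (d - 1) + Finsupp.single j m)) (CentreBlowup.step p Finset.univ j 0 s).F =
      coeff (s.r + (Finsupp.single f (d - 1) + Finsupp.single j (m + 1))) s.F := by
  have hrf : s.r f = 0 := by rw [hr]; simp [hjf.symm, hif.symm, huf.symm]
  have hrdeg : s.r.degree = 2 * n + w := by
    rw [hr, map_add, map_add, Finsupp.degree_single, Finsupp.degree_single, Finsupp.degree_single]; ring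
  have hdegM : (Finsupp.single f (d - 1) + Finsupp.single j (m + 1) : Fin 4 →₀ ℕ).degree = d + m := by
    rw [map_add, Finsupp.degree_single, Finsupp.degree_single]; omega
  have hupd : (Finsupp.single f (d - 1) + Finsupp.single j (m + 1) : Fin 4 →₀ ℕ).update j
      ((Finsupp.single f (d - 1) + Finsupp.single j (m + 1) : Fin 4 →₀ ℕ).degree - d) =
      Finsupp.single f (d - 1) + Finsupp.single j m := by
    rw [hdegM]
    ext k; by_cases hk : k = j
    · subst hk; simp [hjf]
    · simp [Finsupp.coe_update, Function.update_of_ne hk, Finsupp.single_apply, Ne.symm hk]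
  rw [← hupd, ← chartExponent_sigma_add p hσ hji hju hr (by rw [hdegM]; omega),
    coeff_step_zero_chartExponent p j s hq (by rw [map_add, hrdeg, hdegM]; omega),
    if_neg (not_isPthPowerExponent_of_not_dvd (i := f) ?_)]
  rw [chartExponent_sigma_add p hσ hji hju hr (by rw [hdegM]; omega), hupd, Finsupp.add_apply, hrf, Finsupp.add_apply,
    Finsupp.single_eq_same, Finsupp.single_apply, if_neg hjf, zero_add, add_zero]
  intro hdvd
  have := Nat.le_of_dvd (by omega) hdvd
  omega

end Letters

/-! ## 3. Along a pure-corner two-slot play: the run letter's Tschirnhaus powers stay dead, and the `htsch` binder after a change -/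

section Play

variable {j i u f : Fin 4} (hji : j ≠ i) (hju : j ≠ u) (hjf : j ≠ f) (hiu : i ≠ u) (hif : i ≠ f) (huf : u ≠ f)
include hji hju hjf hiu hif huf

/-- **All pure powers of the run letter stay dead along a run.**  Play `s (t+1) = step p univ (κ t) 0 (s t)` with `κ t ∈ {j, i}`, σ-boundary and
`ord₀ ≥ p` at every time; if at time `t₁` every `coeff (r + (d−1)·f + m·(κ t₁)) (s t₁).F`, `m ≥ 2`, vanishes and `κ` is constant on
`[t₁, t₁ + k]`, then the same holds at `t₁ + k` ((B) iterated). [OURS] -/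
theorem tschRow_pure_of_run_sigma (p : ℕ) {n w d : ℕ} (hσ : n + w + d = p) (hn : 1 ≤ n) (hd2 : 2 ≤ d)
    {s : ℕ → State K} {κ : ℕ → Fin 4} (hstep : ∀ t, s (t + 1) = CentreBlowup.step p Finset.univ (κ t) 0 (s t))
    (hκ : ∀ t, κ t = j ∨ κ t = i) (hr : ∀ t, (s t).r = Finsupp.single j n + Finsupp.single i n + Finsupp.single u w)
    (hq : ∀ t, ((p : ℕ) : ℕ∞) ≤ ordAlong Finset.univ (s t).F) {t₁ : ℕ}
    (h0 : ∀ m, 2 ≤ m → coeff ((s t₁).r + (Finsupp.single f (d - 1) + Finsupp.single (κ t₁) m)) (s t₁).F = 0)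
    {k : ℕ} (hrun : ∀ t, t₁ ≤ t → t ≤ t₁ + k → κ t = κ t₁) :
    ∀ m, 2 ≤ m → coeff ((s (t₁ + k)).r + (Finsupp.single f (d - 1) + Finsupp.single (κ (t₁ + k)) m)) (s (t₁ + k)).F = 0 := by
  induction k with
  | zero => simpa using h0
  | succ k ih =>
    intro m hm
    have hκk : κ (t₁ + k) = κ t₁ := hrun _ (by omega) (by omega)
    have hκk1 : κ (t₁ + (k + 1)) = κ t₁ := hrun _ (by omega) le_rfl
    have ih' := ih (fun t ht ht' => hrun t ht (by omega))
    rw [hκk1, show t₁ + (k + 1) = t₁ + k + 1 by ring, hstep (t₁ + k), hκk]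
    -- the boundary is the same letters at `t₁ + k`
    rw [show (CentreBlowup.step p Finset.univ (κ t₁) 0 (s (t₁ + k))).r = (s (t₁ + k)).r by
      rw [← hκk, ← hstep]; rw [hr, hr]]
    rcases hκ t₁ with hj | hi
    · rw [hj, coeff_tschRow_pure_step_zero_sigma hji hju hjf hif huf p hσ hn hd2 (hr _) (hq _) (by omega)]
      have := ih' (m + 1) (by omega)
      rwa [hκk, hj] at this
    · have hr' : (s (t₁ + k)).r = Finsupp.single i n + Finsupp.single j n + Finsupp.single u w := by
        rw [hr, add_comm (Finsupp.single j n)]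
      rw [hi, coeff_tschRow_pure_step_zero_sigma hji.symm hiu hif hjf huf p hσ hn hd2 hr' (hq _) (by omega)]
      have := ih' (m + 1) (by omega)
      rwa [hκk, hi] at this

/-- **THE `htsch` BINDER AFTER A LETTER CHANGE IS AUTOMATIC.**  Same play; if the chart letter changes between `t₀` and `t₀ + 1` and stays
constant on `[t₀ + 1, t₀ + 1 + k]`, then at time `t₀ + 1 + k` every pure power `m ≥ 2` of the current letter is dead in the Tschirnhaus row —
in particular `coeff (r + (d−1)·f + 2·(κ (t₀+1+k))) (s (t₀+1+k)).F = 0`, the binder of `twoSlot_legal_readings_of_corner_sigma` ((A) at the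
change, then (B) along the run). [OURS] -/
theorem htsch_of_change_sigma (p : ℕ) {n w d : ℕ} (hσ : n + w + d = p) (hn : 1 ≤ n) (hd2 : 2 ≤ d)
    {s : ℕ → State K} {κ : ℕ → Fin 4} (hstep : ∀ t, s (t + 1) = CentreBlowup.step p Finset.univ (κ t) 0 (s t))
    (hκ : ∀ t, κ t = j ∨ κ t = i) (hr : ∀ t, (s t).r = Finsupp.single j n + Finsupp.single i n + Finsupp.single u w)
    (hdiv : ∀ t, ∀ e ∈ (s t).F.support, (s t).r ≤ e) (hq : ∀ t, ((p : ℕ) : ℕ∞) ≤ ordAlong Finset.univ (s t).F) {t₀ : ℕ}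
    (hchange : κ (t₀ + 1) ≠ κ t₀) {k : ℕ} (hrun : ∀ t, t₀ + 1 ≤ t → t ≤ t₀ + 1 + k → κ t = κ (t₀ + 1)) :
    ∀ m, 2 ≤ m →
      coeff ((s (t₀ + 1 + k)).r + (Finsupp.single f (d - 1) + Finsupp.single (κ (t₀ + 1 + k)) m)) (s (t₀ + 1 + k)).F = 0 := by
  refine tschRow_pure_of_run_sigma hji hju hjf hiu hif huf p hσ hn hd2 hstep hκ hr hq (t₁ := t₀ + 1) ?_ hrun
  -- at the change: (A) for the step `t₀` in the OTHER letter
  intro m hm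
  rw [hstep t₀]
  rw [show (CentreBlowup.step p Finset.univ (κ t₀) 0 (s t₀)).r = (s t₀).r by rw [← hstep]; rw [hr, hr]]
  rcases hκ t₀ with hj | hi
  · -- step in `j`, current letter `i`
    have hcur : κ (t₀ + 1) = i := by
      rcases hκ (t₀ + 1) with h | h
      · exact absurd (h.trans hj.symm) hchange
      · exact h
    rw [hj, hcur]
    have h := coeff_tschRow_step_zero_eq_zero_sigma hji hju hjf hiu hif huf p hσ (hr t₀) (hdiv t₀) (hq t₀) (a := m) (b := 0)
      (by omega)
    rwa [Finsupp.single_zero, add_zero] at h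
  · -- step in `i`, current letter `j`
    have hcur : κ (t₀ + 1) = j := by
      rcases hκ (t₀ + 1) with h | h
      · exact h
      · exact absurd (h.trans hi.symm) hchange
    rw [hi, hcur]
    have hr' : (s t₀).r = Finsupp.single i n + Finsupp.single j n + Finsupp.single u w := by
      rw [hr, add_comm (Finsupp.single j n)]
    have h := coeff_tschRow_step_zero_eq_zero_sigma hji.symm hiu hif hju hjf huf p hσ hr' (hdiv t₀) (hq t₀) (a := m) (b := 0)
      (by omega)
    rwa [Finsupp.single_zero, add_zero] at h

end Play

end ResCone

end Summit.ResolutionOfSingularities.ResolutionOfSingularities.Theorems.PIDim4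

end
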